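import Summits.AnomalousDissipation.AnomalousDissipation.Theorems.CubicParityLoud.Negative.EnergyRow

/-!
# Negative knowledge for the crux `MomentParity.CubicParityLoud` (stmt-AnomalousDissipation-11465), III:
# load-bearing hypotheses, tightness, refuted strengthenings

Certified copy of §4–§5 of the cdisprove work file `Cruxes/CubicParityLoud/Disproof.lean`
(refuter-cdisprove-stmt-AnomalousDissipation-11465-0, cycle 1). Supports stmt-AnomalousDissipation-11465;
nothing here closes an item.

* §4 `f ≠ 0`, `IsDivFree f`, `HasZeroMean f` are each LOAD-BEARING: the crux with any one of them dropped is
  false (`cubicParityLoud_false_without_nonzero / _divFree / _zeroMean`): the dropped hypothesis admits a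
  force doing no work on `H` and the energy row gives dissipation `0 < ε`.
* §5 TIGHTNESS: `ε ≤ 4π²N²νE` at level `N` (Taylor threshold forced), the `ν`-uniform-`N₀` strengthening
  is false (`not_cubicParityLoudUniformLevel`), the force-uniform `(E, ε, ν₀)` strengthening is false
  (`not_cubicParityLoudUniformInForce`), every witness does work `∫ (u,f) dμ ≥ ε`, and no witness is
  symmetric under `u ↦ −u` (`IsWitness.map_neg_ne`).
-/

noncomputable section

namespace Summit.AnomalousDissipation.AnomalousDissipation.Theorems.CubicParityLoud.Negative

open MeasureTheory Filter UnitAddTorus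
open scoped InnerProductSpace RealInnerProductSpace ENNReal
open Literature.Analysis.FunctionSpaces Literature.Analysis.FluidPDE
open Summit.AnomalousDissipation.AnomalousDissipation.Theses.MomentParity

/-! ## §4 LOAD-BEARING HYPOTHESES: each of `f ≠ 0`, `IsDivFree f`, `HasZeroMean f` is necessary

In each case the dropped hypothesis admits a force doing no work on `H` (`(u, f) = 0` for all
`u ∈ H`), and the energy row forces `ensembleDissipation = ∫ (u,f) dμ = 0 < ε`. So any proof of the
crux must USE `f ≠ 0`, solenoidality and the mean-zero condition — all three exactly through the
injected power `(f, ū)`. (`IsSmooth f` is NOT load-bearing in this sense: the construction only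
ever sees `P_N f`.) -/

section LoadBearing

/-- A force that does no work on `H` has no witness with `ε > 0`. -/
theorem no_witness_of_pairing_eq_zero {f : T3 → R3} (hf : MemLp f 2 volume)
    (hwork : ∀ u : H3, Torus.pairing u.1 f = 0) {ν : ℝ} {N : ℕ} {E ε : ℝ} (hε : 0 < ε)
    {μ : Measure H3} (hW : IsWitness f ν N E ε μ) : False := by
  have h := hW.2.2.2.2.2
  rw [hW.dissipation_eq hf] at h
  simp_rw [hwork] at h
  rw [integral_zero] at h
  exact absurd h (not_le.2 hε)

/-- The crux with `f ≠ 0` DROPPED. -/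
def CubicParityLoudWithoutNonzero : Prop :=
  ∀ f : T3 → R3, Torus.IsSmooth f → Torus.IsDivFree f → Torus.HasZeroMean f →
    ∃ E ε ν₀ : ℝ, 0 < ε ∧ 0 < ν₀ ∧ ∀ ν : ℝ, 0 < ν → ν < ν₀ → ∃ N₀ : ℕ, ∀ N : ℕ, N₀ ≤ N →
      ∃ μ : Measure H3, IsWitness f ν N E ε μ

/-- `f ≠ 0` is load-bearing: witness `f = 0` (energy row ⇒ dissipation `= 0 < ε`). -/
theorem cubicParityLoud_false_without_nonzero : ¬ CubicParityLoudWithoutNonzero := by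
  intro h
  obtain ⟨E, ε, ν₀, hε, hν₀, h⟩ := h 0 isSmooth_zeroForce isDivFree_zeroForce hasZeroMean_zeroForce
  obtain ⟨N₀, hN⟩ := h (ν₀ / 2) (by positivity) (by linarith)
  obtain ⟨μ, hW⟩ := hN N₀ le_rfl
  exact no_witness_of_pairing_eq_zero (memLp_of_isSmooth isSmooth_zeroForce) pairing_zeroForce hε hW

/-- The crux with `IsDivFree f` DROPPED. -/
def CubicParityLoudWithoutDivFree : Prop :=
  ∀ f : T3 → R3, Torus.IsSmooth f → Torus.HasZeroMean f → f ≠ 0 →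
    ∃ E ε ν₀ : ℝ, 0 < ε ∧ 0 < ν₀ ∧ ∀ ν : ℝ, 0 < ν → ν < ν₀ → ∃ N₀ : ℕ, ∀ N : ℕ, N₀ ≤ N →
      ∃ μ : Measure H3, IsWitness f ν N E ε μ

/-- `IsDivFree f` is load-bearing: witness the gradient mode `cos(2πx₁) e₁` (invisible to `H`). -/
theorem cubicParityLoud_false_without_divFree : ¬ CubicParityLoudWithoutDivFree := by
  intro h
  obtain ⟨E, ε, ν₀, hε, hν₀, h⟩ := h gradForce isSmooth_gradForce hasZeroMean_gradForce gradForce_ne_zero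
  obtain ⟨N₀, hN⟩ := h (ν₀ / 2) (by positivity) (by linarith)
  obtain ⟨μ, hW⟩ := hN N₀ le_rfl
  exact no_witness_of_pairing_eq_zero (memLp_of_isSmooth isSmooth_gradForce) pairing_gradForce hε hW

/-- The crux with `HasZeroMean f` DROPPED. -/
def CubicParityLoudWithoutZeroMean : Prop :=
  ∀ f : T3 → R3, Torus.IsSmooth f → Torus.IsDivFree f → f ≠ 0 →
    ∃ E ε ν₀ : ℝ, 0 < ε ∧ 0 < ν₀ ∧ ∀ ν : ℝ, 0 < ν → ν < ν₀ → ∃ N₀ : ℕ, ∀ N : ℕ, N₀ ≤ N →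
      ∃ μ : Measure H3, IsWitness f ν N E ε μ

/-- `HasZeroMean f` is load-bearing: witness the constant wind force `e₁` (invisible to `H`). -/
theorem cubicParityLoud_false_without_zeroMean : ¬ CubicParityLoudWithoutZeroMean := by
  intro h
  obtain ⟨E, ε, ν₀, hε, hν₀, h⟩ := h windForce isSmooth_windForce isDivFree_windForce windForce_ne_zero
  obtain ⟨N₀, hN⟩ := h (ν₀ / 2) (by positivity) (by linarith)
  obtain ⟨μ, hW⟩ := hN N₀ le_rfl
  exact no_witness_of_pairing_eq_zero (memLp_of_isSmooth isSmooth_windForce) (fun u => pairing_const u _) hε hW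

end LoadBearing

/-! ## §5 TIGHTNESS of the quantifier order and of the constants -/

section Tightness

/-- STRENGTHENING (refuted): the level threshold `N₀` chosen BEFORE the viscosity `ν`. -/
def CubicParityLoudUniformLevel : Prop :=
  ∀ f : T3 → R3, Torus.IsSmooth f → Torus.IsDivFree f → Torus.HasZeroMean f → f ≠ 0 →
    ∃ (E ε ν₀ : ℝ) (N₀ : ℕ), 0 < ε ∧ 0 < ν₀ ∧ ∀ ν : ℝ, 0 < ν → ν < ν₀ → ∀ N : ℕ, N₀ ≤ N →
      ∃ μ : Measure H3, IsWitness f ν N E ε μ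

/-- Energy of a witness is non-negative, so `0 ≤ E`. -/
theorem IsWitness.energy_nonneg {f : T3 → R3} {ν : ℝ} {N : ℕ} {E ε : ℝ} {μ : Measure H3}
    (hW : IsWitness f ν N E ε μ) : 0 ≤ E :=
  (integral_nonneg fun u => by positivity).trans hW.2.2.2.2.1

/-- **Bernstein kills ν-uniform levels**: a witness at level `N` has `ε ≤ 4π²N²ν E`. -/
theorem IsWitness.le_bernstein {f : T3 → R3} {ν : ℝ} (hν : 0 ≤ ν) {N : ℕ} {E ε : ℝ} {μ : Measure H3}
    (hW : IsWitness f ν N E ε μ) : ε ≤ 4 * Real.pi ^ 2 * (N : ℝ) ^ 2 * ν * E := by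
  obtain ⟨hP, hlev, h3, -, hE, hε⟩ := hW
  have h2 : Integrable (fun u : H3 => ‖u‖ ^ 2) μ := integrable_norm_pow_of_cube h3 (p := 2) (by norm_num)
  calc ε ≤ Torus.ensembleDissipation ν μ := hε
    _ ≤ 4 * Real.pi ^ 2 * (N : ℝ) ^ 2 * ν * Torus.ensembleEnergy μ := ensembleDissipation_le_of_isLevel hlev h2 hν
    _ ≤ 4 * Real.pi ^ 2 * (N : ℝ) ^ 2 * ν * E := mul_le_mul_of_nonneg_left hE (by positivity)

/-- `N₀` must grow as `ν → 0` (like `ν^{-1/2}`): the `ν`-uniform strengthening is FALSE for every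
admissible force; witnessed on the shear force. No stationarity is used — only the support clause,
`Integrable ‖u‖³` and Bernstein `‖∇u‖² ≤ 4π²N²‖u‖²`. -/
theorem not_cubicParityLoudUniformLevel : ¬ CubicParityLoudUniformLevel := by
  intro h
  obtain ⟨E, ε, ν₀, N₀, hε, hν₀, h⟩ :=
    h shearForce isSmooth_shearForce isDivFree_shearForce hasZeroMean_shearForce shearForce_ne_zero
  -- a first witness gives `0 ≤ E`
  obtain ⟨μ₁, hW₁⟩ := h (ν₀ / 2) (by positivity) (by linarith) N₀ le_rfl
  have hE : 0 ≤ E := hW₁.energy_nonneg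
  set c : ℝ := 4 * Real.pi ^ 2 * (N₀ : ℝ) ^ 2 with hc
  have hc0 : 0 ≤ c := by positivity
  set ν : ℝ := min (ν₀ / 2) (ε / (2 * (c * E + 1))) with hν
  have hcE : 0 < c * E + 1 := by positivity
  have hνpos : 0 < ν := lt_min (by positivity) (by positivity)
  have hνlt : ν < ν₀ := (min_le_left _ _).trans_lt (by linarith)
  obtain ⟨μ, hW⟩ := h ν hνpos hνlt N₀ le_rfl
  have hb := hW.le_bernstein hνpos.le
  rw [← hc] at hb
  have hν2 : ν ≤ ε / (2 * (c * E + 1)) := min_le_right _ _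
  have key : c * ν * E ≤ ε / 2 := by
    calc c * ν * E = (c * E) * ν := by ring
      _ ≤ (c * E) * (ε / (2 * (c * E + 1))) := mul_le_mul_of_nonneg_left hν2 (by positivity)
      _ = (ε / 2) * ((c * E) / (c * E + 1)) := by field_simp
      _ ≤ (ε / 2) * 1 := by
          refine mul_le_mul_of_nonneg_left ?_ (by positivity)
          rw [div_le_one hcE]; linarith
      _ = ε / 2 := mul_one _
  linarith

/-- STRENGTHENING (refuted): a loudness constant `ε` (and budget `E`, range `ν₀`) UNIFORM IN THE FORCE. -/
def CubicParityLoudUniformInForce : Prop :=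
  ∃ E ε ν₀ : ℝ, 0 < ε ∧ 0 < ν₀ ∧
    ∀ f : T3 → R3, Torus.IsSmooth f → Torus.IsDivFree f → Torus.HasZeroMean f → f ≠ 0 →
      ∀ ν : ℝ, 0 < ν → ν < ν₀ → ∃ N₀ : ℕ, ∀ N : ℕ, N₀ ≤ N → ∃ μ : Measure H3, IsWitness f ν N E ε μ

/-- Scaling a smooth / div-free / mean-zero / non-zero force. -/
theorem isDivFree_smul {f : T3 → R3} (hf : Torus.IsSmooth f) (hd : Torus.IsDivFree f) (c : ℝ) :
    Torus.IsDivFree (c • f) := by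
  intro x
  have hu : Torus.IsContDiff 1 f := hf.isContDiff (by simp)
  have h : Torus.divergence (c • f) x = c * Torus.divergence f x := by
    unfold Torus.divergence
    rw [Finset.mul_sum]
    refine Finset.sum_congr rfl fun i _ => ?_
    have hui : Torus.IsContDiff 1 (fun y => f y i) :=
      (EuclideanSpace.proj i : R3 →L[ℝ] ℝ).contDiff.comp hu
    have h : (fun y => (c • f) y i) = c • fun y => f y i := by
      funext y; simp
    rw [h, Torus.partialDeriv_const_smul hui]
    rfl
  rw [h, hd x, mul_zero]

/-- Scaling preserves zero mean. -/
theorem hasZeroMean_smul {f : T3 → R3} (hz : Torus.HasZeroMean f) (c : ℝ) : Torus.HasZeroMean (c • f) := by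
  rw [Torus.HasZeroMean] at hz ⊢
  simp only [Pi.smul_apply]
  rw [integral_smul, hz, smul_zero]

/-- Non-zero scaling of a non-zero force is non-zero. -/
theorem smul_ne_zero_of_ne_zero {f : T3 → R3} (hf : f ≠ 0) {c : ℝ} (hc : c ≠ 0) : c • f ≠ 0 :=
  smul_ne_zero hc hf

/-- The pairing is linear in the force. -/
theorem pairing_smul (u : H3) (f : T3 → R3) (c : ℝ) : Torus.pairing u.1 (c • f) = c * Torus.pairing u.1 f := by
  rw [Torus.pairing, Torus.pairing, ← integral_const_mul]
  refine integral_congr_ae (ae_of_all _ fun x => ?_)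
  simp only [Pi.smul_apply, real_inner_smul_right]

/-- `ε` cannot be uniform in `f`: scale the shear force down, `ε ≤ ∫ (u, δ f₀) ≤ δ ‖f₀‖₂ √E → 0`. -/
theorem not_cubicParityLoudUniformInForce : ¬ CubicParityLoudUniformInForce := by
  rintro ⟨E, ε, ν₀, hε, hν₀, h⟩
  set A : ℝ := Real.sqrt (∫ x, ‖shearForce x‖ ^ 2) with hA
  have hA0 : 0 ≤ A := Real.sqrt_nonneg _
  -- a first witness gives `0 ≤ E`
  obtain ⟨N₁, hN₁⟩ := h shearForce isSmooth_shearForce isDivFree_shearForce hasZeroMean_shearForce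
    shearForce_ne_zero (ν₀ / 2) (by positivity) (by linarith)
  obtain ⟨μ₁, hW₁⟩ := hN₁ N₁ le_rfl
  have hE : 0 ≤ E := hW₁.energy_nonneg
  set δ : ℝ := ε / (2 * (A * Real.sqrt E + 1)) with hδ
  have hden : 0 < A * Real.sqrt E + 1 := by positivity
  have hδpos : 0 < δ := by positivity
  have hsm : Torus.IsSmooth (δ • shearForce) := isSmooth_shearForce.smul δ
  obtain ⟨N₀, hN⟩ := h (δ • shearForce) hsm (isDivFree_smul isSmooth_shearForce isDivFree_shearForce δ)
    (hasZeroMean_smul hasZeroMean_shearForce δ) (smul_ne_zero_of_ne_zero shearForce_ne_zero hδpos.ne')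
    (ν₀ / 2) (by positivity) (by linarith)
  obtain ⟨μ, hW⟩ := hN N₀ le_rfl
  haveI := hW.1
  have h2 : Integrable (fun u : H3 => ‖u‖ ^ 2) μ := integrable_norm_pow_of_cube hW.2.2.1 (p := 2) (by norm_num)
  have hdis := hW.dissipation_eq (memLp_of_isSmooth hsm)
  simp_rw [pairing_smul] at hdis
  rw [integral_const_mul] at hdis
  have hbound : ε ≤ δ * (A * Real.sqrt E) := by
    calc ε ≤ Torus.ensembleDissipation (ν₀ / 2) μ := hW.2.2.2.2.2
      _ = δ * ∫ u, Torus.pairing u.1 shearForce ∂μ := hdis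
      _ ≤ δ * (A * Real.sqrt (Torus.ensembleEnergy μ)) :=
          mul_le_mul_of_nonneg_left (integral_pairing_le (memLp_of_isSmooth isSmooth_shearForce) h2) hδpos.le
      _ ≤ δ * (A * Real.sqrt E) := by
          gcongr
          exact hW.2.2.2.2.1
  have key : δ * (A * Real.sqrt E) ≤ ε / 2 := by
    rw [hδ]
    calc ε / (2 * (A * Real.sqrt E + 1)) * (A * Real.sqrt E)
        = (ε / 2) * ((A * Real.sqrt E) / (A * Real.sqrt E + 1)) := by field_simp
      _ ≤ (ε / 2) * 1 := by
          refine mul_le_mul_of_nonneg_left ?_ (by positivity)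
          rw [div_le_one hden]; linarith
      _ = ε / 2 := mul_one _
  linarith

/-- **LOUDNESS = MEAN-FLOW WORK.** Every witness does work `∫ (u,f) dμ ≥ ε > 0` against the force;
in particular the mean flow `ū` is non-zero and positively correlated with `f` (`(f, ū) ≥ ε`). -/
theorem IsWitness.integral_pairing_ge {f : T3 → R3} (hf : MemLp f 2 volume) {ν : ℝ} {N : ℕ} {E ε : ℝ}
    {μ : Measure H3} (hW : IsWitness f ν N E ε μ) : ε ≤ ∫ u, Torus.pairing u.1 f ∂μ := by
  rw [← hW.dissipation_eq hf]; exact hW.2.2.2.2.2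

/-- The pairing is odd in `u`. -/
theorem pairing_neg (u : H3) (f : T3 → R3) : Torus.pairing (-u).1 f = -Torus.pairing u.1 f := by
  rw [Torus.pairing, Torus.pairing, ← integral_neg]
  refine integral_congr_ae ?_
  have h : (((-u : H3) : L2T3) : T3 → R3) =ᵐ[volume] -(((u : H3) : L2T3) : T3 → R3) := by
    rw [show ((-u : H3) : L2T3) = -((u : H3) : L2T3) from rfl]
    exact Lp.coeFn_neg _
  filter_upwards [h] with x hx
  rw [show (-u).1 = ((-u : H3) : L2T3) from rfl, hx, Pi.neg_apply, inner_neg_left]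

/-- STRENGTHENING (refuted) / structural constraint: **no witness is symmetric under `u ↦ −u`**
(so no centred Gaussian, no absolute-equilibrium Gibbs law `exp(−βE−γH)`, no law built from `±`-paired
atoms alone can witness the crux — the mean flow must break the symmetry). -/
theorem IsWitness.map_neg_ne {f : T3 → R3} (hf : MemLp f 2 volume) {ν : ℝ} {N : ℕ} {E ε : ℝ} (hε : 0 < ε)
    {μ : Measure H3} (hW : IsWitness f ν N E ε μ) : μ.map (fun u : H3 => -u) ≠ μ := by
  intro hsymm
  have hge := hW.integral_pairing_ge hf
  have hcont : Continuous fun u : H3 => Torus.pairing u.1 f := Torus.continuous_pairing_coe hf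
  have h1 : ∫ u, Torus.pairing u.1 f ∂μ = ∫ u, Torus.pairing u.1 f ∂(μ.map fun u : H3 => -u) := by
    rw [hsymm]
  rw [integral_map (continuous_neg.measurable.aemeasurable) hcont.aestronglyMeasurable] at h1
  simp_rw [pairing_neg, integral_neg] at h1
  have : ∫ u, Torus.pairing u.1 f ∂μ = 0 := by linarith
  linarith

end Tightness


end Summit.AnomalousDissipation.AnomalousDissipation.Theorems.CubicParityLoud.Negative
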